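import Literature.AnabelianGeometry.EtaleTheta.FrobenioidThetaTower
import Literature.AnabelianGeometry.EtaleTheta.Discharge.Sec5ModelCase

/-!
# [EtTh] §5, Theorem 5.7 at ALL levels: the level-wise lift to abc-iut-L2-t4's tower (Rmk. 4.3.2, pp. 318–319 / PDF pp. 92–93)

Mochizuki, *The étale theta function …*, Publ. RIMS **45** (2009)
[cite: MochizukiEtTh2009, Thm 5.7 p.329–330 (PDF pp.103–104); Rmk 4.3.2 p.318–319 (PDF pp.92–93)].  Seat
abc-iut-L2-d4 (node `EtTh:Thm5.7`); PROOF-ONLY over abc-iut-L2-t4's `FrobenioidThetaTower.lean`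
(`ThetaFrobenioidTower`, `atLevel`, `ThetaRootPreservedAll`) and this seat's `Discharge/Sec5Thm57.lean` /
`Sec5ModelCase.lean`.

`(𝔗.atLevel N).pre` is `𝔗.pre` DEFINITIONALLY, so the [FrdI]-level hypotheses of `Sec5Thm57.thetaRootPreserved_of`
(total epimorphicity, isotropic type, Def. 1.3 (iii)(d), "`Ψ` preserves pre-steps", base-equivalence) are stated
ONCE, level-free, and the per-level theorem lifts verbatim to `ThetaRootPreservedAll Ψ` (= Thm. 5.7 at the
root level for every `N ≥ 1`, the form in which "compatible systems as in Remark 4.3.2" enter the proofs of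
Thm. 5.7 / 5.10 (ii)); the per-level residuals are Prop. 5.3 (vi) read at `A_N` (`hdiv N`) and the rigidity
clause of Thm. 5.7 read at level `N` (`hrig N`, equivalently print's "`2l`-th root of unity" form `hζ N` via
`mem_muTorsion_inf_OKxRootN_of_pow_eq_const`) — the latter is what the all-levels Kummer argument
(Prop. 3.2 (iii) + Cor. 2.8 (i) + Thm. 5.6 + Prop. 5.2 (iii)) is to discharge on this carrier.
HONEST FRAMING: kernel-checked implications; typed ≠ discharged; no side taken on anything downstream. -/

namespace Literature.AnabelianGeometry.EtaleTheta

open CategoryTheory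
open Literature.AlgebraicGeometry.Frobenioids

universe w v v' u u'

/-! ### T2 toolkit (generic): automorphisms lying over compatible automorphisms are compatible along the transitions

For the all-levels argument (abc-iut-L2-t4's THM57-TOWER-PLAN.md, row T2: "COMPATIBLE choice across levels … under
pull-back of units along `β_{N,N′}`"), the categorical mechanism is epi-cancellation along the Remark 4.3.2 squares
`s_{N′} ≫ β = α ≫ s_N`: an automorphism `D` of `B_N` lying over `a ∈ Aut(A_N)` via `s_N` and an automorphism `D′` of
`B_{N′}` lying over `a′ ∈ Aut(A_{N′})` via `s_{N′}`, with `a, a′` compatible along `α`, are compatible along `β`. -/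

section Generic

variable {C₀ : Type u} [Category.{v} C₀]

/-- **Compatibility along a transition square** (Rmk. 4.3.2, p.318 (PDF p.92): "`s′_{N′} ; β_{N,N′} = α_{N,N′} ; s′_N`"):
if `s ≫ D = a ≫ s`, `s′ ≫ D′ = a′ ≫ s′`, `α ≫ a = a′ ≫ α` and `s′ ≫ β = α ≫ s` with `s′` an epimorphism ([FrdI] Def. 1.3:
totally epimorphic), then `β ≫ D = D′ ≫ β`.  [cite: MochizukiEtTh2009, Rmk 4.3.2 p.318 (PDF p.92)] -/
theorem comp_eq_comp_of_over_square {A B A' B' : C₀} {s : A ⟶ B} {s' : A' ⟶ B'} [Epi s'] {α : A' ⟶ A}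
    {β : B' ⟶ B} (hsq : s' ≫ β = α ≫ s) {D : B ⟶ B} {D' : B' ⟶ B'} {a : A ⟶ A} {a' : A' ⟶ A'}
    (hD : s ≫ D = a ≫ s) (hD' : s' ≫ D' = a' ≫ s') (ha : α ≫ a = a' ≫ α) : β ≫ D = D' ≫ β := by
  rw [← cancel_epi s']
  calc s' ≫ β ≫ D = α ≫ s ≫ D := by rw [← Category.assoc, hsq, Category.assoc]
    _ = α ≫ a ≫ s := by rw [hD]
    _ = a' ≫ α ≫ s := by rw [← Category.assoc, ha, Category.assoc]
    _ = a' ≫ s' ≫ β := by rw [hsq]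
    _ = s' ≫ D' ≫ β := by rw [← Category.assoc, ← hD', Category.assoc]

/-- The same for automorphisms (`Aut`): the level-`N` and level-`N′` automorphisms lying over compatible
automorphisms of the two domains commute with the transition `β`.
[cite: MochizukiEtTh2009, Rmk 4.3.2 p.318 (PDF p.92)] -/
theorem aut_comp_eq_comp_of_over_square {A B A' B' : C₀} {s : A ⟶ B} {s' : A' ⟶ B'} [Epi s'] {α : A' ⟶ A}
    {β : B' ⟶ B} (hsq : s' ≫ β = α ≫ s) {D : Aut B} {D' : Aut B'} {a : Aut A} {a' : Aut A'}
    (hD : s ≫ D.hom = a.hom ≫ s) (hD' : s' ≫ D'.hom = a'.hom ≫ s') (ha : α ≫ a.hom = a'.hom ≫ α) :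
    β ≫ D.hom = D'.hom ≫ β :=
  comp_eq_comp_of_over_square hsq hD hD' ha

end Generic

namespace ThetaFrobenioidTower

variable {C : Type u} [Category.{v} C] {D : Type u'} [Category.{v'} D] (𝔗 : ThetaFrobenioidTower.{w} C D)
  (Ψ : C ≌ C)

/-- **[EtTh] Theorem 5.7 (root level) at ALL levels, modulo its printed inputs** — the level-wise lift of
`ThetaFrobenioid.thetaRootPreserved_of`: the [FrdI] inputs stated once over `𝔗.pre` (`(𝔗.atLevel N).pre = 𝔗.pre`
definitionally), the divisor transport (Prop. 5.3 (vi) at `A_N`) and the rigidity clause per level.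
[cite: MochizukiEtTh2009, Thm 5.7 p.329–330 (PDF pp.103–104); Rmk 4.3.2 p.319 (PDF p.93)] -/
theorem thetaRootPreservedAll_of (hepi : ∀ ⦃X Y : C⦄ (f : X ⟶ Y), Epi f) (hiso : 𝔗.pre.IsOfIsotropicType)
    (hiiid : ∀ ⦃A B B' : C⦄ (φ : A ⟶ B) (φ' : A ⟶ B'), 𝔗.pre.IsCoAngularPreStep φ →
      𝔗.pre.IsCoAngularPreStep φ' → 𝔗.pre.div φ ∣ 𝔗.pre.div φ' →
        ∃ f : B ⟶ B', 𝔗.pre.IsCoAngularPreStep f ∧ φ ≫ f = φ')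
    (hpre : PreFrobenioidData.PreservesMor Ψ.functor 𝔗.pre.IsPreStep 𝔗.pre.IsPreStep)
    (hbe : ∀ ⦃A B : C⦄ (φ ψ : A ⟶ B), 𝔗.pre.BaseEquivalent φ ψ →
      𝔗.pre.BaseEquivalent (Ψ.functor.map φ) (Ψ.functor.map ψ))
    (hdiv : ∀ (N : ℕ+) (α : Ψ.functor.obj (𝔗.AN N) ≅ 𝔗.AN N) (β : Ψ.functor.obj (𝔗.BN N) ≅ 𝔗.BN N),
      ∃ e : 𝔗.AN N ≅ 𝔗.AN N,
        𝔗.pre.div (α.inv ≫ Ψ.functor.map (𝔗.sCap N) ≫ β.hom) = 𝔗.pre.div (e.hom ≫ 𝔗.sCap N) ∧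
        𝔗.pre.div (α.inv ≫ Ψ.functor.map (𝔗.sCup N) ≫ β.hom) = 𝔗.pre.div (e.hom ≫ 𝔗.sCup N))
    (hrig : ∀ (N : ℕ+) (α : Ψ.functor.obj (𝔗.AN N) ≅ 𝔗.AN N) (β : Ψ.functor.obj (𝔗.BN N) ≅ 𝔗.BN N)
      (e : 𝔗.AN N ≅ 𝔗.AN N) (Dc Dp : Aut (𝔗.BN N)),
      α.inv ≫ Ψ.functor.map (𝔗.sCap N) ≫ β.hom = e.hom ≫ 𝔗.sCap N ≫ Dc.hom →
      α.inv ≫ Ψ.functor.map (𝔗.sCup N) ≫ β.hom = e.hom ≫ 𝔗.sCup N ≫ Dp.hom →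
      Dc⁻¹ * Dp ∈ (𝔗.atLevel N).units (𝔗.BN N) →
        Dc⁻¹ * Dp ∈ (𝔗.atLevel N).muTorsion (𝔗.BN N) (2 * 𝔗.l * N) ⊓ (𝔗.atLevel N).OKxRootN) :
    𝔗.ThetaRootPreservedAll Ψ :=
  fun N => ThetaFrobenioid.thetaRootPreserved_of (𝔉 := 𝔗.atLevel N) Ψ hepi hiso hiiid hpre hbe (hdiv N) (hrig N)

/-- The same with the per-level rigidity clause in PRINT'S FORM ("up to possible multiplication by a `2l`-th root
of unity", Thm. 5.7 p.330 (PDF p.104)): at level `N` the unit discrepancy `u` has `u^N = ζ_N` in `O^×(B_N^birat)` for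
some `ζ_N ∈ μ_{2l}(K)` — `mem_muTorsion_inf_OKxRootN_of_pow_eq_const` converts it into the `δ₂`-clause.
[cite: MochizukiEtTh2009, Thm 5.7 p.330 (PDF p.104); Rmk 4.3.2 p.319 (PDF p.93)] -/
theorem thetaRootPreservedAll_of_rootOfUnity (hepi : ∀ ⦃X Y : C⦄ (f : X ⟶ Y), Epi f)
    (hiso : 𝔗.pre.IsOfIsotropicType)
    (hiiid : ∀ ⦃A B B' : C⦄ (φ : A ⟶ B) (φ' : A ⟶ B'), 𝔗.pre.IsCoAngularPreStep φ →
      𝔗.pre.IsCoAngularPreStep φ' → 𝔗.pre.div φ ∣ 𝔗.pre.div φ' →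
        ∃ f : B ⟶ B', 𝔗.pre.IsCoAngularPreStep f ∧ φ ≫ f = φ')
    (hpre : PreFrobenioidData.PreservesMor Ψ.functor 𝔗.pre.IsPreStep 𝔗.pre.IsPreStep)
    (hbe : ∀ ⦃A B : C⦄ (φ ψ : A ⟶ B), 𝔗.pre.BaseEquivalent φ ψ →
      𝔗.pre.BaseEquivalent (Ψ.functor.map φ) (Ψ.functor.map ψ))
    (hdiv : ∀ (N : ℕ+) (α : Ψ.functor.obj (𝔗.AN N) ≅ 𝔗.AN N) (β : Ψ.functor.obj (𝔗.BN N) ≅ 𝔗.BN N),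
      ∃ e : 𝔗.AN N ≅ 𝔗.AN N,
        𝔗.pre.div (α.inv ≫ Ψ.functor.map (𝔗.sCap N) ≫ β.hom) = 𝔗.pre.div (e.hom ≫ 𝔗.sCap N) ∧
        𝔗.pre.div (α.inv ≫ Ψ.functor.map (𝔗.sCup N) ≫ β.hom) = 𝔗.pre.div (e.hom ≫ 𝔗.sCup N))
    (hζ : ∀ (N : ℕ+) (α : Ψ.functor.obj (𝔗.AN N) ≅ 𝔗.AN N) (β : Ψ.functor.obj (𝔗.BN N) ≅ 𝔗.BN N)
      (e : 𝔗.AN N ≅ 𝔗.AN N) (Dc Dp : Aut (𝔗.BN N)),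
      α.inv ≫ Ψ.functor.map (𝔗.sCap N) ≫ β.hom = e.hom ≫ 𝔗.sCap N ≫ Dc.hom →
      α.inv ≫ Ψ.functor.map (𝔗.sCup N) ≫ β.hom = e.hom ≫ 𝔗.sCup N ≫ Dp.hom →
      ∀ hu : Dc⁻¹ * Dp ∈ (𝔗.atLevel N).units (𝔗.BN N), ∃ ζ : 𝔗.Kˣ, ζ ^ (2 * 𝔗.l) = 1 ∧
        (𝔗.atLevel N).unitsToBirat (𝔗.BN N) ⟨Dc⁻¹ * Dp, hu⟩ ^ (N : ℕ) = 𝔗.constEmb N ζ) :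
    𝔗.ThetaRootPreservedAll Ψ :=
  𝔗.thetaRootPreservedAll_of Ψ hepi hiso hiiid hpre hbe hdiv fun N α β e Dc Dp hT hT' hu => by
    obtain ⟨ζ, hζ1, hζ2⟩ := hζ N α β e Dc Dp hT hT' hu
    exact ThetaFrobenioid.mem_muTorsion_inf_OKxRootN_of_pow_eq_const (𝔉 := 𝔗.atLevel N) hu ζ hζ1 hζ2

/-! ### T2 (v2, append-only): the discrepancy units of two levels correspond along `β_{N,N′}` — abc-iut-L2-t4's
THM57-TOWER-PLAN row T2, PROVED by epi-cancellation from level identifications compatible with the Remark 4.3.2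
transitions and divisor-matching automorphisms compatible along `α_{N,N′}` -/

section GenericT2

variable {C₀ : Type u} [Category.{v} C₀] (Ψ : C₀ ≌ C₀)

/-- **T2, step 1 — the transported sections satisfy the transition squares.**  If the identifications
`αi : Ψ(A) ≅ A`, `αi′ : Ψ(A′) ≅ A′`, `βi : Ψ(B) ≅ B`, `βi′ : Ψ(B′) ≅ B′` are compatible with the transition
`(α, β)` of Remark 4.3.2 ("`Ψ` maps the commutative diagrams `s_{N′} ; β = α ; s_N` to the corresponding diagrams",
Rmk. 4.3.2 p.318 (PDF p.92) / Cor. 5.12 p.339 (PDF p.113): `αi′⁻¹ ≫ Ψ(α) ≫ αi = α`, `βi′⁻¹ ≫ Ψ(β) ≫ βi = β`), then the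
transported sections `t := αi⁻¹ ≫ Ψ(s) ≫ βi`, `t′ := αi′⁻¹ ≫ Ψ(s′) ≫ βi′` again satisfy `t′ ≫ β = α ≫ t`.
[cite: MochizukiEtTh2009, Rmk 4.3.2 p.318 (PDF p.92)] -/
theorem transport_comm_of_compat {A B A' B' : C₀} {s : A ⟶ B} {s' : A' ⟶ B'} {α : A' ⟶ A} {β : B' ⟶ B}
    (hsq : s' ≫ β = α ≫ s) (αi : Ψ.functor.obj A ≅ A) (αi' : Ψ.functor.obj A' ≅ A')
    (βi : Ψ.functor.obj B ≅ B) (βi' : Ψ.functor.obj B' ≅ B')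
    (hΨα : αi'.inv ≫ Ψ.functor.map α ≫ αi.hom = α) (hΨβ : βi'.inv ≫ Ψ.functor.map β ≫ βi.hom = β) :
    (αi'.inv ≫ Ψ.functor.map s' ≫ βi'.hom) ≫ β = α ≫ (αi.inv ≫ Ψ.functor.map s ≫ βi.hom) := by
  have hβ' : βi'.hom ≫ β = Ψ.functor.map β ≫ βi.hom := by
    calc βi'.hom ≫ β = βi'.hom ≫ (βi'.inv ≫ Ψ.functor.map β ≫ βi.hom) := by rw [hΨβ]
      _ = Ψ.functor.map β ≫ βi.hom := by rw [Iso.hom_inv_id_assoc]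
  have hα' : α ≫ αi.inv = αi'.inv ≫ Ψ.functor.map α := by
    calc α ≫ αi.inv = (αi'.inv ≫ Ψ.functor.map α ≫ αi.hom) ≫ αi.inv := by rw [hΨα]
      _ = αi'.inv ≫ Ψ.functor.map α := by simp only [Category.assoc, Iso.hom_inv_id, Category.comp_id]
  calc (αi'.inv ≫ Ψ.functor.map s' ≫ βi'.hom) ≫ β
      = αi'.inv ≫ Ψ.functor.map s' ≫ Ψ.functor.map β ≫ βi.hom := by
        simp only [Category.assoc, hβ']
    _ = αi'.inv ≫ Ψ.functor.map (s' ≫ β) ≫ βi.hom := by rw [Functor.map_comp, Category.assoc]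
    _ = αi'.inv ≫ Ψ.functor.map α ≫ Ψ.functor.map s ≫ βi.hom := by rw [hsq, Functor.map_comp, Category.assoc]
    _ = (α ≫ αi.inv) ≫ Ψ.functor.map s ≫ βi.hom := by rw [hα', Category.assoc]
    _ = α ≫ (αi.inv ≫ Ψ.functor.map s ≫ βi.hom) := by rw [Category.assoc]

/-- **T2, step 2 — the codomain automorphisms of the two levels are compatible along `β`.**  If
`t = e ≫ s ≫ D`, `t′ = e′ ≫ s′ ≫ D′` (the transport equations of the two levels, `Sec5Thm57.exists_codTransport_of_div_eq`)
with `t′ ≫ β = α ≫ t` (step 1), `s′ ≫ β = α ≫ s` (Rmk. 4.3.2) and `α ≫ e = e′ ≫ α` (the divisor-matching automorphisms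
compatible along `α` — one automorphism of `A_⊚` read at all levels, Prop. 5.3 (vi)), then `D′ ≫ β = β ≫ D`
(`s′` epi, [FrdI] Def. 1.3).  [cite: MochizukiEtTh2009, Rmk 4.3.2 p.318 (PDF p.92)] -/
theorem cod_comp_beta_of_transport {A B A' B' : C₀} {s : A ⟶ B} {s' : A' ⟶ B'} [Epi s'] {α : A' ⟶ A}
    {β : B' ⟶ B} (hsq : s' ≫ β = α ≫ s) {t : A ⟶ B} {t' : A' ⟶ B'} (ht : t' ≫ β = α ≫ t)
    {e : A ≅ A} {e' : A' ≅ A'} {D : Aut B} {D' : Aut B'} (hT : t = e.hom ≫ s ≫ D.hom)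
    (hT' : t' = e'.hom ≫ s' ≫ D'.hom) (he : α ≫ e.hom = e'.hom ≫ α) : D'.hom ≫ β = β ≫ D.hom := by
  rw [hT, hT'] at ht
  -- `e′ ≫ s′ ≫ D′ ≫ β = α ≫ e ≫ s ≫ D = e′ ≫ α ≫ s ≫ D = e′ ≫ s′ ≫ β ≫ D`
  have h1 : e'.hom ≫ s' ≫ D'.hom ≫ β = e'.hom ≫ s' ≫ β ≫ D.hom := by
    calc e'.hom ≫ s' ≫ D'.hom ≫ β = (e'.hom ≫ s' ≫ D'.hom) ≫ β := by simp only [Category.assoc]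
      _ = α ≫ e.hom ≫ s ≫ D.hom := ht
      _ = e'.hom ≫ α ≫ s ≫ D.hom := by rw [← Category.assoc, he, Category.assoc]
      _ = e'.hom ≫ s' ≫ β ≫ D.hom := by rw [← Category.assoc α s, ← hsq, Category.assoc]
  exact (cancel_epi s').mp ((cancel_epi e'.hom).mp h1)

/-- **T2 — the discrepancy units of two levels correspond along `β_{N,N′}`**: with `D_c, D_p` (level `N`) and
`D_c′, D_p′` (level `N′`) as in step 2 for the `s^⊓`- and the `s^⊔`-squares, the units `u := D_c⁻¹·D_p`,
`u′ := D_c′⁻¹·D_p′` satisfy `u′ ≫ β = β ≫ u` — "by allowing `N` to vary, we obtain a compatible system" (Rmk. 4.3.2,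
p.319 (PDF p.93)); row T2 of abc-iut-L2-t4's THM57-TOWER-PLAN.  [cite: MochizukiEtTh2009, Rmk 4.3.2 p.319 (PDF p.93)] -/
theorem discrepancy_comp_beta {B B' : C₀} {β : B' ⟶ B} {Dc Dp : Aut B} {Dc' Dp' : Aut B'}
    (hc : Dc'.hom ≫ β = β ≫ Dc.hom) (hp : Dp'.hom ≫ β = β ≫ Dp.hom) :
    (Dc'⁻¹ * Dp').hom ≫ β = β ≫ (Dc⁻¹ * Dp).hom := by
  have hc' : Dc'.inv ≫ β = β ≫ Dc.inv := by
    rw [← cancel_epi Dc'.hom, ← Category.assoc, Dc'.hom_inv_id, Category.id_comp, ← Category.assoc, hc,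
      Category.assoc, Dc.hom_inv_id, Category.comp_id]
  simp only [Aut.Aut_mul_def, Aut.Aut_inv_def, Iso.trans_hom, Iso.symm_hom, Category.assoc]
  rw [hc', ← Category.assoc, hp, Category.assoc]

end GenericT2

section TowerT2

variable {C : Type u} [Category.{v} C] {D : Type u'} [Category.{v'} D] (𝔗 : ThetaFrobenioidTower.{w} C D)
  (Ψ : C ≌ C)

/-- **T2 on the tower** (THM57-TOWER-PLAN row T2): for `N ∣ N′`, level identifications compatible with the Remark 4.3.2
transitions (`hΨα`, `hΨβ`: "`Ψ` maps the transition diagram to the transition diagram", Cor. 5.12 setting p.339) and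
divisor-matching automorphisms compatible along `α_{N,N′}` (`he`), the level-`N` and level-`N′` transport data of
`Sec5Thm57.exists_codTransport_of_div_eq` have codomain automorphisms — hence unit discrepancies — compatible along
`β_{N,N′}`: `u_{N′} ≫ β_{N,N′} = β_{N,N′} ≫ u_N`.  (`C` totally epimorphic, [FrdI] Def. 1.3.)
[cite: MochizukiEtTh2009, Rmk 4.3.2 p.318–319 (PDF pp.92–93)] -/
theorem discrepancy_comp_beta_of_transports (hepi : ∀ ⦃X Y : C⦄ (f : X ⟶ Y), Epi f) {N N' : ℕ+}
    (h : (N : ℕ) ∣ N') (αi : Ψ.functor.obj (𝔗.AN N) ≅ 𝔗.AN N) (αi' : Ψ.functor.obj (𝔗.AN N') ≅ 𝔗.AN N')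
    (βi : Ψ.functor.obj (𝔗.BN N) ≅ 𝔗.BN N) (βi' : Ψ.functor.obj (𝔗.BN N') ≅ 𝔗.BN N')
    (hΨα : αi'.inv ≫ Ψ.functor.map (𝔗.α h) ≫ αi.hom = 𝔗.α h)
    (hΨβ : βi'.inv ≫ Ψ.functor.map (𝔗.β h) ≫ βi.hom = 𝔗.β h)
    {e : 𝔗.AN N ≅ 𝔗.AN N} {e' : 𝔗.AN N' ≅ 𝔗.AN N'} (he : 𝔗.α h ≫ e.hom = e'.hom ≫ 𝔗.α h)
    {Dc Dp : Aut (𝔗.BN N)} {Dc' Dp' : Aut (𝔗.BN N')}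
    (hT : αi.inv ≫ Ψ.functor.map (𝔗.sCap N) ≫ βi.hom = e.hom ≫ 𝔗.sCap N ≫ Dc.hom)
    (hT2 : αi.inv ≫ Ψ.functor.map (𝔗.sCup N) ≫ βi.hom = e.hom ≫ 𝔗.sCup N ≫ Dp.hom)
    (hT' : αi'.inv ≫ Ψ.functor.map (𝔗.sCap N') ≫ βi'.hom = e'.hom ≫ 𝔗.sCap N' ≫ Dc'.hom)
    (hT2' : αi'.inv ≫ Ψ.functor.map (𝔗.sCup N') ≫ βi'.hom = e'.hom ≫ 𝔗.sCup N' ≫ Dp'.hom) :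
    Dc'.hom ≫ 𝔗.β h = 𝔗.β h ≫ Dc.hom ∧ Dp'.hom ≫ 𝔗.β h = 𝔗.β h ≫ Dp.hom ∧
      (Dc'⁻¹ * Dp').hom ≫ 𝔗.β h = 𝔗.β h ≫ (Dc⁻¹ * Dp).hom := by
  haveI := hepi (𝔗.sCap N')
  haveI := hepi (𝔗.sCup N')
  have hc := cod_comp_beta_of_transport (𝔗.comm_sCap h)
    (transport_comm_of_compat Ψ (𝔗.comm_sCap h) αi αi' βi βi' hΨα hΨβ) hT hT' he
  have hp := cod_comp_beta_of_transport (𝔗.comm_sCup h)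
    (transport_comm_of_compat Ψ (𝔗.comm_sCup h) αi αi' βi βi' hΨα hΨβ) hT2 hT2' he
  exact ⟨hc, hp, discrepancy_comp_beta hc hp⟩

end TowerT2

end ThetaFrobenioidTower

end Literature.AnabelianGeometry.EtaleTheta
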